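import Literature.MathematicalPhysics.QuantumFieldTheory.Borinsky2020.HeppSectorCoordinates
import HarnessLib

/-!
# Volkov's sector integral of the Hepp-sector density (PRD 96 §III.C, the evaluation of eq. (19)): in the affine chart of one sector the density `∏_l t_l^{Deg_l}/∏ y` integrates to `1/∏_l Deg_l` — PROVED

independent recomputation; certified where stated, statistical where stated; no new-physics claim.

CITATION HEADER (venture `QEDPrecision`, cell `pub-qed`, track TROPICAL seat V3a = `pub-qed-trop-v3-lit-1` gen 8; VALUE-FREE: an identity of
elementary integrals in the symbols `Deg(s) > 0`; no constant, nothing per graph or per Set V family). Companion of `FastSamplingTable.lean`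
(the discrete half: the table W, (23), (24), the sector law) and the continuous counterpart of its `sectorIntegral` (the printed VALUE
`1/∏_{l=2}^{n} Deg({j_l,…,j_n})`): here that value is shown to BE the integral Volkov writes after his Lemma 1, i.e. the per-sector
normalisation of g₀ in the affine chart. Serves `tropical/view/V3-VOLKOV-DEGREES.md` §A A.2.3 ("exact normalisation 1/∏_l Deg(s^{[l]}) per
sector").

Source [Volkov2017]: S. Volkov, Phys. Rev. D 96, 096018 (2017) = arXiv:1705.05800, §III.C "Fast sampling algorithm" (e-print
`amm4_mc_arxiv.tex` l.916–933 = arXiv PDF p.17 and l.956–971 = p.18), VERBATIM: "Using the proved lemma [Lemma 1 `lemma_sum_to_max`: the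
projective change of variables (20)–(21)] and the substitution z_{j_l} = y_l/(1+y₂+…+y_n), 1 ≤ l ≤ n, (21) where y₁ = 1, we obtain that
(19) [= ∫_{z>0, z∈S_{j₁,…,j_n}} g₀(z) δ(z₁+…+z_n−1) dz] equals ∫_{1 ≥ y₂ ≥ y₃ ≥ … ≥ y_n > 0} ∏_{l=2}^{n} (y_l/y_{l−1})^{Deg({j_l,j_{l+1},…,j_n})}
/ (y₂…y_n) dy₂…dy_n. By the substitution t_l = y_l/y_{l−1} (22) we obtain that it equals 1/∏_{l=2}^{n} Deg({j_l,j_{l+1},…,j_n})." and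
"Applying (22) we obtain that the generation is equivalent to the independent generation of t_l, 0 ≤ t_l ≤ 1, 2 ≤ l ≤ n with the
probability densities C · t^{Deg({j_l,…,j_n})−1}."  (§III.B (16): "Deg(s) > 0".)

TYPING, in the tree's Hepp-sector vocabulary (`Borinsky2020/HeppSectorCoordinates.lean`, INCREASING convention): Volkov's chart variables
(y_n, y_{n−1}, …, y₂) — smallest first — are the coordinates `a 0 ≤ a 1 ≤ ⋯ ≤ a m ≤ 1` of `heppCube m` with `m + 1 = n − 1`
(`a k = y_{n−k}`); his ratios `t_l = y_l/y_{l−1}` are EXACTLY the sector variables `heppInv a`: `heppInv a k = a k / a (k+1) = t_{n−k}` for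
`k < m` and `heppInv a m = a m = y₂ = t₂` (because y₁ = 1); the exponent carried by `t_{n−k}` is `Deg({j_{n−k},…,j_n})`, the Deg of the
tail set of size `k + 1`, typed as a vector `D : Fin (m+1) → ℝ` (`D k` = Deg of the tail set of the `k + 1` smallest parameters). So the
displayed y-integrand is `(∏_k (heppInv a k)^{D k}) / ∏_k a k` on `heppCube m`, and the theorem `integral_heppCube_sectorDensity` says its
integral is `∏_k (D k)⁻¹` whenever every `D k > 0` — Volkov's "it equals 1/∏_{l=2}^{n} Deg(…)", by his own route (22): in the sector
variables the Jacobian `∏_k β_k^k` (`Borinsky2020.integral_heppCube_eq_integral_heppUnitBox`) turns the integrand into the product of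
INDEPENDENT one-dimensional densities `β_k^{D k − 1}` on `(0,1]` ("independent generation of t_l … with the probability densities
C · t^{Deg−1}"), each integrating to `1/D k`.
NOT typed here: Lemma 1 itself (the passage from the simplex δ(Σz − 1) form (19) to the affine chart y₁ = 1 — Volkov's own lemma with the
Jacobian (20); the tree's `HeppSectorCoordinates` works in the affine chart from the start), the sum over sectors (discrete half:
`FastSamplingTable.lean`), and anything about Deg.
-/

namespace Literature.MathematicalPhysics.QuantumFieldTheory.Volkov2017

open MeasureTheory Set Real
open Borinsky2020

variable {m : ℕ}

/-- In the sector variables the y-integrand times the Hepp Jacobian is the product of independent one-dimensional densities: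
`(∏_k β_k^k) · (∏_k t_k^{D_k}) / ∏_k y_k = ∏_k β_k^{D_k − 1}` with `t = heppInv (heppMap β) = β` and `∏_k y_k = ∏_k β_k^{k+1}`
("the generation is equivalent to the independent generation of t_l … with the probability densities C · t^{Deg({j_l,…,j_n})−1}").
[cite: Volkov2017, §III.C (display after eq. (22), tex l.965–971)] -/
theorem jacobian_mul_sectorDensity_heppMap {β : Fin (m + 1) → ℝ} (hβ : ∀ j, 0 < β j) (D : Fin (m + 1) → ℝ) :
    (∏ k : Fin (m + 1), β k ^ (k : ℕ)) * ((∏ k, heppInv (heppMap β) k ^ D k) / ∏ k, heppMap β k) =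
      ∏ k : Fin (m + 1), β k ^ (D k - 1) := by
  have hcard : ∀ k : Fin (m + 1), (Finset.univ.filter (· ≤ k)).card = (k : ℕ) + 1 := fun k => by
    rw [Finset.filter_ge_eq_Iic, Fin.card_Iic]
  rw [heppInv_heppMap fun j => (hβ j).ne', prod_heppMap_eq β Finset.univ, mul_div_assoc', ← Finset.prod_mul_distrib,
    ← Finset.prod_div_distrib]
  refine Finset.prod_congr rfl fun k _ => ?_
  rw [hcard k, pow_succ, Real.rpow_sub_one (hβ k).ne']
  have hk : β k ^ (k : ℕ) ≠ 0 := pow_ne_zero _ (hβ k).ne'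
  field_simp

/-- **Volkov's evaluation of the sector integral (19) in the affine chart**: "∫_{1 ≥ y₂ ≥ … ≥ y_n > 0} ∏_{l=2}^{n}
(y_l/y_{l−1})^{Deg({j_l,…,j_n})} / (y₂…y_n) dy₂…dy_n … equals 1/∏_{l=2}^{n} Deg({j_l,j_{l+1},…,j_n})" — in increasing coordinates
`a k = y_{n−k}` on `heppCube m` (`m + 1 = n − 1`), with `heppInv a` = Volkov's ratios t and `D k` = the Deg of the tail set of size
`k + 1`: `∫_{heppCube} (∏_k (heppInv a k)^{D k}) / ∏_k a k da = ∏_k (D k)⁻¹` for every positive exponent vector `D` (the printed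
"Deg(s) > 0"). Route = the paper's (22): Hepp's change of variables, then `m + 1` independent integrals `∫₀¹ β^{D−1} dβ = 1/D`.
[cite: Volkov2017, §III.C (displays after eq. (21) `eq_subst_zy` and eq. (22) `eq_subst_yt`, tex l.916–933; arXiv PDF p.17)] -/
theorem integral_heppCube_sectorDensity (D : Fin (m + 1) → ℝ) (hD : ∀ k, 0 < D k) :
    ∫ a in heppCube m, (∏ k, heppInv a k ^ D k) / ∏ k, a k = ∏ k : Fin (m + 1), (D k)⁻¹ := by
  rw [integral_heppCube_eq_integral_heppUnitBox]
  have hcongr : EqOn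
      (fun β : Fin (m + 1) → ℝ => (∏ k : Fin (m + 1), β k ^ (k : ℕ)) • ((∏ k, heppInv (heppMap β) k ^ D k) / ∏ k, heppMap β k))
      (fun β => ∏ k : Fin (m + 1), β k ^ (D k - 1)) (heppUnitBox m) := by
    intro β hβ
    simp only [smul_eq_mul]
    exact jacobian_mul_sectorDensity_heppMap (fun j => (hβ j).1) D
  rw [setIntegral_congr_fun measurableSet_heppUnitBox hcongr, heppUnitBox_eq_pi, volume_pi, Measure.restrict_pi_pi]
  have hprod := integral_fintype_prod_eq_prod (𝕜 := ℝ)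
    (μ := fun _ : Fin (m + 1) => (volume : Measure ℝ).restrict (Ioc 0 1))
    (fun (k : Fin (m + 1)) (y : ℝ) => y ^ (D k - 1))
  rw [hprod]
  refine Finset.prod_congr rfl fun k _ => ?_
  rw [← intervalIntegral.integral_of_le zero_le_one, integral_rpow (Or.inl (by linarith [hD k])), sub_add_cancel,
    Real.one_rpow, Real.zero_rpow (hD k).ne', sub_zero, one_div]

/-- The one-sector normalisation is positive (so each sector's share `[1/∏Deg]/Σ_a W(Λ∖{a})` of `FastSamplingTable.genProb_eq` is a
ratio of positive integrals). [cite: Volkov2017, §III.C (display after eq. (22)) with §III.B "Deg(s) > 0"] -/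
theorem integral_heppCube_sectorDensity_pos (D : Fin (m + 1) → ℝ) (hD : ∀ k, 0 < D k) :
    0 < ∫ a in heppCube m, (∏ k, heppInv a k ^ D k) / ∏ k, a k := by
  rw [integral_heppCube_sectorDensity D hD]
  exact Finset.prod_pos fun k _ => inv_pos.mpr (hD k)

end Literature.MathematicalPhysics.QuantumFieldTheory.Volkov2017
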